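import Summits.QuantumFields.YangMills.Theorems.BalabanUVNodesK0PrintCubeOfStepTokensGuarded
import Summits.QuantumFields.YangMills.Theorems.BalabanUVNodesK0V19Stub2Prime
import Summits.QuantumFields.YangMills.Theorems.BalabanUVNodesK0PrintCubeOfStepTokensRFloor
import Literature.MathematicalPhysics.QuantumFieldTheory.Balaban1983to89.Node00.CriticalOnFibreTopGuarded
import Literature.MathematicalPhysics.QuantumFieldTheory.Balaban1983to89.Node00.Record12BgRowCoClassCPMFloor
import Literature.MathematicalPhysics.QuantumFieldTheory.Balaban1983to89.Node00.TorusCoverGaugeTokensGuarded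
import Summits.QuantumFields.YangMills.Theses.BalabanUVNodes

/-!
# K0⁷ V20-G — THE TWO REGISTERED STUB TEXTS AS TREE DEFINITIONS (so that stub proofs can be filed BY NAME), the kernel doors, and K0⁷ by name from the two texts

Cell `pub-ymgap`, width seat `pub-ymgap-k0-s3-w2` (g3; K0⁷ stub-3 lane; director-ym R399 (3a); CLAIM-6 ∕ INTENT-6 on the cell bus 2026-08-28 13:56Z).
`--kind definition --supports stmt-QuantumFields-20541 --as helper`; count-neutral.  The V20-G twin of `Summits.QuantumFields.YangMills.Theorems.BalabanUVNodesK0V19Defs`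
(width seat k0-s2-w1 g0, HUMAN RULING D-0149 ∕ director-ym №197) — same purpose, same shape.
[15] = [Balaban1985Variational]; [6] = [Balaban1985RegularSpaces]; [I] = [Balaban1987RG1]; [II] = [Balaban1989LargeFieldII]; [III] = [Balaban1988Convergent].

WHY.  Plan g86 registered skeleton **V20-G** on K0⁷ stmt-QuantumFields-20541 (`[YMPLAN-G86-K0V20G-REGISTERED dead8a8df885c226]`, bus 2026-08-28 13:43:40Z; file
`HOME/pub-ymgap-plan/D86-K0V20/K0Skeleton13SepCoPHV20G.lean`, sha256 `dead8a8df885c226c7259a14d1c40d1e702c66ea1a27874c45db64c89f58a191`, ns `…Theses.BalabanUVNodes.K0Skeleton13SepCoPHV20G`):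
ACTIVE stubs `stub_prop8StepCoPG13 : ∀ F : T4Family, Prop8StepCoPGAt F` and `stub_absBetaBoxAtThm1WitnessCCMGenG13 : ∀ F : T4Family, AbsBetaBoxAtThm1WitnessCCMGenGAt F` (V19's stubs 1 ∕ 3ᴬ′
EXPIRED; stub 2′ `K0V19Stub2Prime.stub_prop6MemberB8AtP13`, p595104, LANDED and consumed by name).  The gate credits a `--supports 20541` proof only if it proves a registered stub
BY NAME with that VERBATIM header; the two predicates are `def`s LOCAL to the skeleton file, which lives in the plan's HOME folder and is never imported (the tree stays sorry-free) — so
no tree file can spell `Prop8StepCoPGAt F` or `AbsBetaBoxAtThm1WitnessCCMGenGAt F`.  THIS FILE puts the two registered texts into the tree BYTE-FOR-BYTE (l.58–62 and l.71–78 of the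
registered file; docstrings the skeleton's), together with the two R texts the skeleton DISPLAYS for its doors (l.64–67, l.80–87), for every stub lane to import (the skeleton's body type `BodyG` is p635645's
statement and is not re-declared): stub 1-G = N07's head ∕ the k0-s1 seats (doors `K0HalvingStepOfCoreGuardedChain.prop8StepCoPG_of_…`, p634782), stub 3ᴬ′-G = NODE O (sockets `K0AllTorusOfStepTokensGuarded.absBetaBoxAtG_of_jetsFreePairAtG`,
p635083; the stub-3 lane's currencies `K0Stub3V20Sockets` ∕ `…V20GSockets`, p632040 ∕ p637949, whose hypothesis `h3Gb` IS `∀ F, AbsBetaBoxAtThm1WitnessCCMGenGAt F` letter for letter).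
§2 repeats the skeleton's kernel DOORS between the V19 ∕ R ∕ G texts (V19 ⟹ R ⟹ G for stub 1 — G is the WEAKEST stub-1 text; G ⟹ R ⟹ V19 for 3ᴬ′ — G is the STRONGEST 3ᴬ′ text), so the
V19-keyed and R-keyed tree files stay consumable; §3 composes K0⁷ BY NAME from the two texts exactly as the skeleton's `Record13SepCoPHInhabited_of` ∕ `k0SepCoPH_inhabited` do
(k0-s1-w3 g7's `K0PrintCubeOfStepTokensGuarded.record13SepCoPHBody_of_stubs1G_2P_3A'G`, p635645, with the landed 2′ inside).

CONTENTS.  §1 `Prop8StepCoPGAt`, `Prop8StepCoPRAt`, `AbsBetaBoxAtThm1WitnessCCMGenGAt`, `AbsBetaBoxAtThm1WitnessCCMGenRAt` (registered ∕ displayed texts VERBATIM).  §2 doors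
`prop8StepCoPGAt_of_R`, `prop8StepCoPGAt_of_V19`, `absBetaBoxGenRAt_of_genG`, `absBetaBoxGenV19At_of_genG`, and the R-composition sanity `k0HBody_of_stubTextsR`.  §3
`record13SepCoPHBody_of_stubTextsG` (= the skeleton's `Record13SepCoPHInhabited_of`), `record13SepCoPHInhabited_of_stubTextsG` (K0⁷ BY NAME from the two registered texts); K0⁷ ⟺ `∀ F, K0HBodyAt F`
is `K0V19Defs.record13SepCoPHInhabited_iff` (`Iff.rfl`, not restated).

HONEST FRAMING.  Definitions copied from the registered skeleton, kernel doors, and by-name compositions; NOTHING of Bałaban asserted; no stub is proved here; NO β estimate; K0⁷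
stmt-QuantumFields-20541 OPEN (V20-G 0∕2 + 2′ by name), unclaimed; the skeleton of record is the plan's V20-G (this file neither replaces nor re-registers it — it mirrors its texts so that
proofs can be filed by name; if the plan re-cuts, this file is superseded, not edited; `K0V19Defs` stays for the V19-keyed doors).  Counts unmoved (typed 28∕28 · discharged 5∕27).
One finite 𝕋⁴ programme at fixed `ε = L^{−K}`, Bałaban AS PRINTED — NOT continuum ∕ ℝ⁴ ∕ OS ∕ mass gap ∕ Clay: the Yang–Mills mass gap is NOT proved by any of this; route R4 closes the
CONDITIONAL finite-𝕋⁴ rung `BalabanLadder.UV` only.  No `sorry`, `instance`, `notation`; standard axioms.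
-/

open MeasureTheory
open scoped Matrix.Norms.L2Operator
open Literature.MathematicalPhysics.QuantumFieldTheory.Balaban1983to89
open Literature.MathematicalPhysics.QuantumFieldTheory.Balaban1983to89.T4Continuum
open Literature.MathematicalPhysics.QuantumFieldTheory.Balaban1983to89.Node00
open Literature.MathematicalPhysics.QuantumFieldTheory.Balaban1983to89.FlowStep
open Literature.MathematicalPhysics.QuantumFieldTheory.Balaban1983to89.B8LeafModelZd (ZdIdx)
open Summit.QuantumFields.YangMills.Theorems.K0AllTorusOfStepTokensRFloor (prop8StepCoPR_of_prop8StepCoP absBetaBoxAtGen_of_absBetaBoxAtGenR)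
open Summit.QuantumFields.YangMills.Theorems.K0PrintCubeOfStepTokensRFloor (record13SepCoPHBody_of_stubs1R_2P_3A'R)
open Summit.QuantumFields.YangMills.Theorems.K0PrintCubeOfStepTokensGuarded (record13SepCoPHBody_of_stubs1G_2P_3A'G)

namespace Summit.QuantumFields.YangMills.Theorems.K0V20GDefs

/-! ## §1. The two REGISTERED V20-G stub texts (verbatim: l.58–62 ∕ l.71–78 of dead8a8df885c226) and the displayed R texts (l.64–67 ∕ l.80–87) -/

/-- **stub 1-G text** ([15] Prop. 8's top step at NODE 00's support domains, GUARDED: floor `c ≤ ν.M₁` ∧ level guard `k + c₀ ≤ F.m + K`; `c c₀` outermost).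
[cite: Balaban1985Variational, Prop. 8 p.304, p.304 lines 1–2; Balaban1985RegularSpaces, (1.3)–(1.6) p.77; Balaban1987RG1, (0.1) p.251] -/
def Prop8StepCoPGAt (F : T4Family) : Prop :=
  ∃ (c c₀ : ℕ) (B₃ a₀ a₁ : ℝ), 2 * (F.L : ℝ) ^ 2 ≤ B₃ ∧ 0 < a₀ ∧ 0 < a₁ ∧
    Prop8RegSepTopStepG F 2 (fun ν K Ω => suppDomOfRecord F ν K Ω)
      (fun ν _M _g K k _s => c ≤ ν.M₁ ∧ k + c₀ ≤ F.m + K) B₃ a₀ a₁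

/-- stub 1-R text (V20-R, p630277's `h1R` at `F`; displayed for the doors only). [cite: Balaban1985RegularSpaces, (1.3)–(1.6) p.77 (bookkeeping)] -/
def Prop8StepCoPRAt (F : T4Family) : Prop :=
  ∃ (c : ℕ) (B₃ a₀ a₁ : ℝ), 2 * (F.L : ℝ) ^ 2 ≤ B₃ ∧ 0 < a₀ ∧ 0 < a₁ ∧
    Prop8RegSepTopStepR F 2 (fun ν K Ω => suppDomOfRecord F ν K Ω) c B₃ a₀ a₁

/-- **stub 3ᴬ′-G text**: the sign-free |β| box at the collared Thm-1-CCM witness `theta13OfThm1CCM F 2 j …` from the GUARDED (8)-sentence and (9)-token (same concrete guard as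
stub 1-G), for every `(j, c, c₀)` with `c ≤ L^j` (floor at the witness numerics `ν.M₁ = L^j`) and `c₀ ≤ j + 1` (level guard at the record's `PartCompat₁₃` prefixes, where
`n + j + 1 ≤ F.m + p.K`). [cite: Balaban1985Variational, Thm 1 (8),(9) p.279; Balaban1988Convergent, (2.5) p.255, p.257; Balaban1987RG1, (1.12) p.262] -/
def AbsBetaBoxAtThm1WitnessCCMGenGAt (F : T4Family) : Prop :=
  ∀ (j c c₀ : ℕ) (B₃ B₃' a₀ a₁ : ℝ), c ≤ F.L ^ j → c₀ ≤ j + 1 → 2 * (F.L : ℝ) ^ 2 ≤ B₃ → 0 < B₃' → 0 < a₀ → 0 < a₁ →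
    VariationalThm1RegSepCoP7MG F 2 (fun ν _M _g K k _s => c ≤ ν.M₁ ∧ k + c₀ ≤ F.m + K) B₃ a₀ a₁ →
    Gauge9RegSepTopStepG F 2 (fun ν K Ω => suppDomOfRecord F ν K Ω) (F.L ^ j) (fun ν _M _g K k _s => c ≤ ν.M₁ ∧ k + c₀ ≤ F.m + K) B₃ B₃' a₀ a₁ →
    ∃ γ₀ ε₀ ε₂₉ β' : ℝ, 0 < γ₀ ∧ 0 < ε₀ ∧ 0 < ε₂₉ ∧
      BetaLowerH (-β') γ₀ (betaOfRecord₁₃ F 2 (theta13OfThm1CCM F 2 j ε₀ ε₂₉ B₃ B₃' a₀ a₁)) ∧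
      BetaUpperH β' γ₀ (betaOfRecord₁₃ F 2 (theta13OfThm1CCM F 2 j ε₀ ε₂₉ B₃ B₃' a₀ a₁))

/-- stub 3ᴬ′-R text (V20-R, p630277's `h3A'R` at `F`; displayed for the doors only). [cite: Balaban1985RegularSpaces, (1.3)–(1.6) p.77 (bookkeeping)] -/
def AbsBetaBoxAtThm1WitnessCCMGenRAt (F : T4Family) : Prop :=
  ∀ (j c : ℕ) (B₃ B₃' a₀ a₁ : ℝ), c ≤ F.L ^ j → 2 * (F.L : ℝ) ^ 2 ≤ B₃ → 0 < B₃' → 0 < a₀ → 0 < a₁ →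
    VariationalThm1RegSepCoP7MR F 2 c B₃ a₀ a₁ →
    Gauge9RegSepTopStepR F 2 (fun ν K Ω => suppDomOfRecord F ν K Ω) (F.L ^ j) c B₃ B₃' a₀ a₁ →
    ∃ γ₀ ε₀ ε₂₉ β' : ℝ, 0 < γ₀ ∧ 0 < ε₀ ∧ 0 < ε₂₉ ∧
      BetaLowerH (-β') γ₀ (betaOfRecord₁₃ F 2 (theta13OfThm1CCM F 2 j ε₀ ε₂₉ B₃ B₃' a₀ a₁)) ∧
      BetaUpperH β' γ₀ (betaOfRecord₁₃ F 2 (theta13OfThm1CCM F 2 j ε₀ ε₂₉ B₃ B₃' a₀ a₁))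

/-! ## §2. Doors between the V19 ∕ R ∕ G texts (kernel; the registered skeleton's §3 verbatim) -/

/-- stub 1: R ⟹ G at `F` (`c₀ := 0`; the floor part of the guard) — G is the WEAKEST stub-1 text. [cite: Balaban1985RegularSpaces, (1.3)–(1.6) p.77 (bookkeeping); Balaban1985Variational, Prop. 8 p.304] -/
theorem prop8StepCoPGAt_of_R (F : T4Family) (h : Prop8StepCoPRAt F) : Prop8StepCoPGAt F := by
  obtain ⟨c, B₃, a₀, a₁, hB₃, ha₀, ha₁, h8⟩ := h
  exact ⟨c, 0, B₃, a₀, a₁, hB₃, ha₀, ha₁, h8.toG_of_imp_floor fun _ _ _ _ _ _ hadm => hadm.1⟩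

/-- stub 1: V19 ⟹ G at `F` (via p630016's V19 ⟹ R `K0AllTorusOfStepTokensRFloor.prop8StepCoPR_of_prop8StepCoP`). [cite: Balaban1985RegularSpaces, (1.3)–(1.6) p.77 (bookkeeping); Balaban1985Variational, Prop. 8 p.304] -/
theorem prop8StepCoPGAt_of_V19 (F : T4Family) (h : Summit.QuantumFields.YangMills.Theorems.K0V19Defs.Prop8StepCoPAt F) : Prop8StepCoPGAt F :=
  prop8StepCoPGAt_of_R F (prop8StepCoPR_of_prop8StepCoP F h)

/-- 3ᴬ′: G ⟹ R at `F` (`c₀ := 0 ≤ j + 1`; the R antecedents serve the guard's floor part) — G is the STRONGEST 3ᴬ′ text. [cite: Balaban1987RG1, (1.12) p.262, §1 p.264 (bookkeeping); Balaban1985RegularSpaces, (1.3)–(1.6) p.77] -/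
theorem absBetaBoxGenRAt_of_genG (F : T4Family) (h : AbsBetaBoxAtThm1WitnessCCMGenGAt F) : AbsBetaBoxAtThm1WitnessCCMGenRAt F :=
  fun j c B₃ B₃' a₀ a₁ hc hB₃ hB₃' ha₀ ha₁ h15 h9 =>
    h j c 0 B₃ B₃' a₀ a₁ hc (Nat.zero_le _) hB₃ hB₃' ha₀ ha₁ (h15.toG_of_imp_floor fun _ _ _ _ _ _ hadm => hadm.1)
      (h9.toG_of_imp_floor fun _ _ _ _ _ _ hadm => hadm.1)

/-- 3ᴬ′: G ⟹ V19 at `F` (via p630016's R ⟹ V19 `K0AllTorusOfStepTokensRFloor.absBetaBoxAtGen_of_absBetaBoxAtGenR`). [cite: Balaban1987RG1, (1.12) p.262, §1 p.264 (bookkeeping); Balaban1985RegularSpaces, (1.3)–(1.6) p.77] -/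
theorem absBetaBoxGenV19At_of_genG (F : T4Family) (h : AbsBetaBoxAtThm1WitnessCCMGenGAt F) :
    Summit.QuantumFields.YangMills.Theorems.K0V19Defs.AbsBetaBoxAtThm1WitnessCCMGenAt F :=
  absBetaBoxAtGen_of_absBetaBoxAtGenR F (absBetaBoxGenRAt_of_genG F h)

/-- SANITY (kernel; the skeleton's R example as a named fact): the V20-R composition in the tree (p630277) consumes the two R texts with the LANDED stub 2′ (p595104).
[cite: Balaban1985RegularSpaces, (1.3)–(1.6) p.77 (bookkeeping)] -/
theorem k0HBody_of_stubTextsR (h1R : ∀ F : T4Family, Prop8StepCoPRAt F) (h3A'R : ∀ F : T4Family, AbsBetaBoxAtThm1WitnessCCMGenRAt F) :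
    ∀ F : T4Family, Summit.QuantumFields.YangMills.Theorems.K0V19Defs.K0HBodyAt F :=
  record13SepCoPHBody_of_stubs1R_2P_3A'R h1R Summit.QuantumFields.YangMills.Theorems.K0V19Stub2Prime.stub_prop6MemberB8AtP13 h3A'R

/-! ## §3. K0⁷ BY NAME from the two registered texts (k0-s1-w3 g7's `record13SepCoPHBody_of_stubs1G_2P_3A'G`, p635645, with the landed stub 2′ p595104 inside) -/

/-- **K0⁷'s body at every family from the two REGISTERED V20-G stub texts (hypothesis form) and the LANDED stub 2′ BY NAME** — the registered skeleton's
`Record13SepCoPHInhabited_of` (l.137–141) verbatim: `record13SepCoPHBody_of_stubs1G_2P_3A'G h1G K0V19Stub2Prime.stub_prop6MemberB8AtP13 h3A'G`.  CONDITIONAL on the two texts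
(stubs 1-G ∕ 3ᴬ′-G — not proved here); K0⁷ OPEN.
[cite: Balaban1985Variational, Thm 1 (8)–(9) p.279, Prop. 8 p.304; Balaban1985RegularSpaces, Prop. 6 p.99; Balaban1988Convergent, Thm 1 p.262, (2.5) p.255; Balaban1987RG1, Thm 1 p.259, §1 p.264] -/
theorem record13SepCoPHBody_of_stubTextsG (h1G : ∀ F : T4Family, Prop8StepCoPGAt F)
    (h3A'G : ∀ F : T4Family, AbsBetaBoxAtThm1WitnessCCMGenGAt F) :
    ∀ F : T4Family, Summit.QuantumFields.YangMills.Theorems.K0V19Defs.K0HBodyAt F :=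
  record13SepCoPHBody_of_stubs1G_2P_3A'G h1G Summit.QuantumFields.YangMills.Theorems.K0V19Stub2Prime.stub_prop6MemberB8AtP13 h3A'G

/-- **★ K0⁷ BY NAME FROM THE TWO REGISTERED V20-G STUB TEXTS** — the term the registered skeleton's `k0SepCoPH_inhabited` becomes the day `stub_prop8StepCoPG13` and
`stub_absBetaBoxAtThm1WitnessCCMGenG13` land by name (`record13SepCoPHInhabited_of_stubTextsG stub_prop8StepCoPG13 stub_absBetaBoxAtThm1WitnessCCMGenG13`).  CONDITIONAL on the
two texts; nothing of [15] ∕ [6] ∕ [I] ∕ [III] asserted; K0⁷ OPEN.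
[cite: Balaban1985Variational, Thm 1 (8)–(9) p.279, Prop. 8 p.304; Balaban1985RegularSpaces, Prop. 6 p.99; Balaban1988Convergent, Thm 1 p.262, (2.5) p.255, p.257; Balaban1987RG1, Thm 1 p.259, (1.12) p.262, §1 p.264] -/
theorem record13SepCoPHInhabited_of_stubTextsG (h1G : ∀ F : T4Family, Prop8StepCoPGAt F)
    (h3A'G : ∀ F : T4Family, AbsBetaBoxAtThm1WitnessCCMGenGAt F) :
    Summit.QuantumFields.YangMills.Theses.BalabanUVNodes.Record13SepCoPHInhabited :=
  record13SepCoPHBody_of_stubTextsG h1G h3A'G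

end Summit.QuantumFields.YangMills.Theorems.K0V20GDefs
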